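import Summits.BirchSwinnertonDyer.BirchSwinnertonDyer.Theorems.SignedLowerHalvesSmallImageLowerHalfBothSignsRttD2FrameConductor
import Summits.BirchSwinnertonDyer.BirchSwinnertonDyer.Theorems.SignedLowerHalvesSmallImageLowerHalfBothSignsRttD2FrameRamification
import Literature.NumberTheory.NumberFields.UnramifiedCompositum
import Literature.NumberTheory.GaloisRepresentations.GoverningFieldOfOpenNormal
import Literature.NumberTheory.GaloisRepresentations.GlobalArtinMapOfCharactersProofs
import Literature.NumberTheory.EllipticCurves.ZpExtensionUnramifiedProofs
import Mathlib.RingTheory.RootsOfUnity.Basic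
import Mathlib.FieldTheory.Galois.Infinite
import HarnessLib

/-!
# Route `SignedLowerHalves`, crux L `SmallImageLowerHalfBothSigns` (stmt-BirchSwinnertonDyer-23599), line `rtt_w3` v19→v20 — THE SUPPORT CONDITIONS (R)/(U) OF THE ROAD-D FRAME:
# the CONDUCTOR `𝔣₀` of the finite-order character `χ₀` (`χ₀ = 1` on `Gal(K̄/K(𝔣₀))`, `χ₀` RAMIFIED at every prime of `𝔣₀`, UNRAMIFIED off `𝔣₀`), and the frame support
# at `𝔣 = 𝔣₀·(p)^e`: `θ'` ramified at every `w ∣ 𝔣`, `w ∤ p` (R) and unramified off `supp(p𝔣)` (U)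

INPUTS hand `bsd-inputs-honda-p1` g25 under LEAD `cruxlead-stmt-BirchSwinnertonDyer-23599` g12 (AUDIT VERDICT 01:25Z, crux dir `Lines/rtt_w3-MEMO-B-fourterm-g12.md`: stub B's four-term
conjunct bloats with imprimitive levels; REPAIR = support conditions (R)+(U) at `𝔣 := cond(L_{χ₀})·p^{N+1}`; ASK: `_of₄`). This file supplies the two new conjuncts as standalone theorems:
* §1 `isOpen_ker_of_pow_eq_one` — a continuous character `χ₀ : Γ_K → 𝒪ˣ` of finite exponent has OPEN kernel (closed of finite index: the image lies in the finite group `μ_M(𝒪)`);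
  ★★ `exists_conductor_of_pow_eq_one` — for `K` totally complex there is `𝔣₀ ≠ 0` (the conductor of the fixed field `L₀` of `ker χ₀`, finite ABELIAN over `K`:
  `exists_isGalois_absGaloisFixingSubgroup_eq`, `InfiniteGalois.isOpen_iff_finite`, `Γ_K/ker χ₀ ↪ 𝒪ˣ`) with (a) `χ₀ = 1` on `Gal(K̄/K(𝔣₀))` (`le_rayClassField_conductor`), (b) `χ₀ τ ≠ 1` for SOME
  inertia element `τ` above every `w ⊇ 𝔣₀` and (c) `χ₀ = 1` on every inertia group above every `w ⊉ 𝔣₀` (Neukirch VI (6.6) `conductor_le_iff_not_isUnramifiedIn` + VII §10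
  `isUnramifiedIn_iff_forall_inertia_absRestrictNormalHom_eq_one` + `ker r_{L₀} = ker χ₀`);
* §2 `le_of_mem_suppPF_mul_pow` (`w ∈ supp(p·𝔣₀p^e)`, `w ∤ p` ⇒ `𝔣₀ ≤ 𝔭_w`); ★★ `frameSupp_ramified` (R) and ★★ `frameSupp_unramified` (U) for `θ'` with `θ' = χ₀` wherever `κ₁ = κ₂ = 1`
  (honda g24's `exists_torsionCharacter`, clause 6) at `𝔣 := 𝔣₀·(p)^e`: the inertia groups at `w ∤ p` lie in `ker κ₁ ⊓ ker κ₂` (`ZpExtension.inertia_le_kerSubgroup_holds`), so there `θ' = χ₀`.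
THEOREMS ONLY (`--supports stmt-BirchSwinnertonDyer-23599` helper); no named fact, no `sorry`; crux L, crux M, E2 and BSD remain OPEN and are proved for NO curve by any of this.
References: [NeukirchANT1999] Ch. VI §6 Def. (6.4), Cor. (6.6), Ch. VII §10 (10.6); [Washington1997] Prop. 13.2; [SerreAbelianLadic1968] Ch. III §2.2 (locally algebraic characters: conductor).
-/

set_option autoImplicit false
-- the Theorems namespace of this sub repeats the summit name by design (D-0017 nested layout)
set_option linter.dupNamespace false

noncomputable section

open scoped NumberField
open Field IsDedekindDomain
open Literature.NumberTheory.GaloisRepresentations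
open Literature.NumberTheory.EllipticCurves
open Literature.NumberTheory.NumberFields
open Literature.NumberTheory.ComplexMultiplication.EllipticUnits.JohnsonLeungKings2011

namespace Summit.BirchSwinnertonDyer.BirchSwinnertonDyer.Theorems.SmallImageRttD2FrameSupport

variable {K : Type} [Field K] [NumberField K] {p : ℕ} [Fact p.Prime] (S : Set (PadicAlgCl p))

/-! ## §1 The conductor of a finite-order character -/

omit [NumberField K] in
/-- **A continuous character `χ₀ : Γ_K → 𝒪ˣ` of finite exponent (`χ₀^M = 1`, `0 < M`) has open kernel**: the kernel is closed (`𝒪ˣ` is `T1`) and of finite index (the image lies in the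
finite group `μ_M(𝒪)` of `M`-th roots of unity of the domain `𝒪`). [cite: SerreAbelianLadic1968, Ch. III §2.2] -/
theorem isOpen_ker_of_pow_eq_one [CharZero K] (χ₀ : absoluteGaloisGroup K →ₜ* (padicCoeffIntegers S)ˣ) {M : ℕ} (hM : 0 < M)
    (hχ : ∀ τ : absoluteGaloisGroup K, χ₀ τ ^ M = 1) :
    IsOpen ((χ₀.toMonoidHom.ker : Subgroup (absoluteGaloisGroup K)) : Set (absoluteGaloisGroup K)) := by
  haveI : NeZero M := ⟨hM.ne'⟩
  -- finite index: the range lies in `rootsOfUnity M 𝒪`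
  have hrange : χ₀.toMonoidHom.range ≤ rootsOfUnity M (padicCoeffIntegers S) := by
    rintro _ ⟨τ, rfl⟩
    exact (mem_rootsOfUnity M _).2 (hχ τ)
  haveI : Finite χ₀.toMonoidHom.range := Finite.of_injective _ (Subgroup.inclusion_injective hrange)
  haveI : Finite (absoluteGaloisGroup K ⧸ χ₀.toMonoidHom.ker) :=
    Finite.of_equiv _ (QuotientGroup.quotientKerEquivRange χ₀.toMonoidHom).symm.toEquiv
  haveI : (χ₀.toMonoidHom.ker).FiniteIndex := Subgroup.finiteIndex_of_finite_quotient
  refine Subgroup.isOpen_of_isClosed_of_finiteIndex _ ?_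
  have hset : ((χ₀.toMonoidHom.ker : Subgroup (absoluteGaloisGroup K)) : Set (absoluteGaloisGroup K)) = χ₀ ⁻¹' {1} := by
    ext τ; simp [MonoidHom.mem_ker]
  rw [hset]
  exact isClosed_singleton.preimage χ₀.continuous_toFun

/-- ★★ **THE CONDUCTOR OF A FINITE-ORDER CHARACTER** (`K` totally complex): for a continuous `χ₀ : Γ_K → 𝒪ˣ` with `χ₀^M = 1` there is an ideal `𝔣₀ ≠ 0` — the conductor of the
finite ABELIAN extension `L₀ = K̄^{ker χ₀}` — such that (a) `χ₀ = 1` on `Gal(K̄/K(𝔣₀))`; (b) above every prime `w ⊇ 𝔣₀` some inertia element `τ` has `χ₀ τ ≠ 1` (`w` ramifies in `L₀`,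
Neukirch VI (6.6)); (c) above every prime `w ⊉ 𝔣₀` every inertia element is killed by `χ₀` (`L₀/K` unramified at `w`). [cite: NeukirchANT1999, Ch. VI §6 Def. (6.4), Cor. (6.6)]
[cite: NeukirchANT1999, Ch. VII §10 Thm. (10.6) (proof)] -/
theorem exists_conductor_of_pow_eq_one [NumberField.IsTotallyComplex K] (χ₀ : absoluteGaloisGroup K →ₜ* (padicCoeffIntegers S)ˣ) {M : ℕ} (hM : 0 < M)
    (hχ : ∀ τ : absoluteGaloisGroup K, χ₀ τ ^ M = 1) :
    ∃ 𝔣₀ : Ideal (𝓞 K), 𝔣₀ ≠ ⊥ ∧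
      (∀ σ ∈ absGaloisFixingSubgroup (rayClassField K 𝔣₀), χ₀ σ = 1) ∧
      (∀ w : HeightOneSpectrum (𝓞 K), 𝔣₀ ≤ w.asIdeal →
        ∃ 𝔓 ∈ w.primesAbove, ∃ τ ∈ 𝔓.inertia (absoluteGaloisGroup K), χ₀ τ ≠ 1) ∧
      (∀ w : HeightOneSpectrum (𝓞 K), ¬ 𝔣₀ ≤ w.asIdeal →
        ∀ 𝔓 ∈ w.primesAbove, ∀ τ ∈ 𝔓.inertia (absoluteGaloisGroup K), χ₀ τ = 1) := by
  -- the fixed field `L₀` of the open normal subgroup `ker χ₀`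
  obtain ⟨L₀, hL, hfix⟩ := exists_isGalois_absGaloisFixingSubgroup_eq K χ₀.toMonoidHom.ker (isOpen_ker_of_pow_eq_one S χ₀ hM hχ)
  haveI := hL
  have hmem : ∀ τ : absoluteGaloisGroup K, τ ∈ absGaloisFixingSubgroup L₀ ↔ χ₀ τ = 1 := fun τ => by
    rw [hfix, MonoidHom.mem_ker]; rfl
  have hres : ∀ τ : absoluteGaloisGroup K, absRestrictNormalHom L₀ τ = 1 ↔ χ₀ τ = 1 := fun τ => by
    rw [← hmem, ← MonoidHom.mem_ker]
  -- `L₀/K` is finite (open fixing subgroup) and abelian (`Γ_K ⧸ ker χ₀ ↪ 𝒪ˣ`)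
  haveI : IsGalois K (AlgebraicClosure K) := {}
  haveI : FiniteDimensional K L₀ := by
    rw [← InfiniteGalois.isOpen_iff_finite L₀]
    have hopen : IsOpen ((absGaloisFixingSubgroup L₀ : Subgroup (absoluteGaloisGroup K)) : Set (absoluteGaloisGroup K)) := by
      rw [hfix]; exact isOpen_ker_of_pow_eq_one S χ₀ hM hχ
    have h1 : L₀.fixingSubgroup.carrier = (absoluteGaloisGroup.toAlgEquiv K).symm ⁻¹'
        ((absGaloisFixingSubgroup L₀ : Subgroup (absoluteGaloisGroup K)) : Set (absoluteGaloisGroup K)) := by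
      ext σ
      change σ ∈ L₀.fixingSubgroup ↔ (absoluteGaloisGroup.toAlgEquiv K).symm σ ∈ absGaloisFixingSubgroup L₀
      rw [← IntermediateField.restrictNormalHom_ker, MonoidHom.mem_ker, MonoidHom.mem_ker, MonoidHom.comp_apply, MulEquiv.coe_toMonoidHom,
        MulEquiv.apply_symm_apply]
    rw [h1]
    exact hopen.preimage continuous_id
  haveI : IsAbelianGalois K L₀ :=
    { is_comm := ⟨fun a b => by
        obtain ⟨σ, rfl⟩ := absRestrictNormalHom_surjective L₀ a
        obtain ⟨τ, rfl⟩ := absRestrictNormalHom_surjective L₀ b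
        rw [← map_mul, ← map_mul, ← div_eq_one, ← map_div, hres, map_div, map_mul, map_mul, div_eq_one, mul_comm]⟩ }
  haveI : NumberField L₀ := NumberField.of_module_finite K _
  refine ⟨conductor L₀, conductor_ne_bot _, fun σ hσ => ?_, fun w hw => ?_, fun w hw 𝔓 h𝔓 τ hτ => ?_⟩
  · -- (a) `L₀ ⊆ K(𝔣₀)`
    rw [← hmem, mem_absGaloisFixingSubgroup_iff]
    rw [mem_absGaloisFixingSubgroup_iff] at hσ
    exact fun x hx => hσ x (le_rayClassField_conductor L₀ hx)
  · -- (b) `w ∣ 𝔣₀ ⇒ w` ramifies in `L₀`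
    have hram : ¬ Algebra.IsUnramifiedIn (𝓞 L₀) w.asIdeal := (conductor_le_iff_not_isUnramifiedIn L₀ w).mp hw
    rw [isUnramifiedIn_iff_forall_inertia_absRestrictNormalHom_eq_one L₀ w] at hram
    push Not at hram
    obtain ⟨𝔓, h𝔓, τ, hτ, hne⟩ := hram
    exact ⟨𝔓, h𝔓, τ, hτ, fun h => hne ((hres τ).2 h)⟩
  · -- (c) `w ∤ 𝔣₀ ⇒ L₀/K` unramified at `w`
    have hunr : Algebra.IsUnramifiedIn (𝓞 L₀) w.asIdeal := by
      by_contra h; exact hw ((conductor_le_iff_not_isUnramifiedIn L₀ w).mpr h)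
    exact (hres τ).1 ((isUnramifiedIn_iff_forall_inertia_absRestrictNormalHom_eq_one L₀ w).mp hunr 𝔓 h𝔓 τ hτ)

/-! ## §2 The frame support conditions (R) and (U) at `𝔣 = 𝔣₀·(p)^e` -/

omit [NumberField K] [Fact p.Prime] in
/-- **`w ∈ supp(p·𝔣₀·p^e)` and `w ∤ p` imply `𝔣₀ ≤ 𝔭_w`** (`𝔭_w` is prime). [cite: JohnsonLeungKings2011, Cor. 5.3 (S = supp p𝔣)] -/
theorem le_of_mem_suppPF_mul_pow {𝔣₀ : Ideal (𝓞 K)} {e : ℕ} {w : HeightOneSpectrum (𝓞 K)}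
    (hw : w ∈ suppPF p (𝔣₀ * Ideal.span {((p : ℕ) : 𝓞 K)} ^ e)) (hpw : ((p : ℕ) : 𝓞 K) ∉ w.asIdeal) : 𝔣₀ ≤ w.asIdeal := by
  have hw' : w.asIdeal ∣ Ideal.span {((p : ℕ) : 𝓞 K)} * (𝔣₀ * Ideal.span {((p : ℕ) : 𝓞 K)} ^ e) := hw
  haveI hprime : w.asIdeal.IsPrime := w.isPrime
  have hnp : ¬ Ideal.span {((p : ℕ) : 𝓞 K)} ≤ w.asIdeal := fun h => hpw ((Ideal.span_singleton_le_iff_mem _).mp h)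
  rcases hprime.mul_le.1 (Ideal.le_of_dvd hw') with h | h
  · exact absurd h hnp
  · rcases hprime.mul_le.1 h with h' | h'
    · exact h'
    · exact absurd (Ideal.IsPrime.le_of_pow_le h') hnp

variable (κ₁ κ₂ : ZpExtension K p) (χ₀ θ' : absoluteGaloisGroup K →ₜ* (padicCoeffIntegers S)ˣ)

/-- ★★ **(R) `θ'` is RAMIFIED at every prime `w ∤ p` of `supp(p𝔣)`, `𝔣 = 𝔣₀·(p)^e`**, when `χ₀` is ramified at every `w ⊇ 𝔣₀` (§1 (b)) and `θ' = χ₀` wherever `κ₁ = κ₂ = 1` (the inertia groups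
at `w ∤ p` lie in `ker κ₁ ⊓ ker κ₂`, `ZpExtension.inertia_le_kerSubgroup_holds`). [cite: NeukirchANT1999, Ch. VI §6 Cor. (6.6)] [cite: Washington1997, Prop. 13.2] -/
theorem frameSupp_ramified (hkerχ : ∀ g : absoluteGaloisGroup K, κ₁ g = 1 → κ₂ g = 1 → θ' g = χ₀ g) {𝔣₀ : Ideal (𝓞 K)}
    (hram : ∀ w : HeightOneSpectrum (𝓞 K), 𝔣₀ ≤ w.asIdeal → ∃ 𝔓 ∈ w.primesAbove, ∃ τ ∈ 𝔓.inertia (absoluteGaloisGroup K), χ₀ τ ≠ 1) (e : ℕ) :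
    ∀ w ∈ suppPF p (𝔣₀ * Ideal.span {((p : ℕ) : 𝓞 K)} ^ e), ((p : ℕ) : 𝓞 K) ∉ w.asIdeal →
      ∃ 𝔓 ∈ w.primesAbove, ∃ τ ∈ 𝔓.inertia (absoluteGaloisGroup K), θ' τ ≠ 1 := by
  intro w hw hpw
  obtain ⟨𝔓, h𝔓, τ, hτ, hne⟩ := hram w (le_of_mem_suppPF_mul_pow hw hpw)
  refine ⟨𝔓, h𝔓, τ, hτ, ?_⟩
  rw [hkerχ τ (ZpExtension.mem_kerSubgroup.mp (ZpExtension.inertia_le_kerSubgroup_holds K p κ₁ hpw h𝔓 hτ))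
    (ZpExtension.mem_kerSubgroup.mp (ZpExtension.inertia_le_kerSubgroup_holds K p κ₂ hpw h𝔓 hτ))]
  exact hne

/-- ★★ **(U) `θ'` is UNRAMIFIED off `supp(p𝔣)`, `𝔣 = 𝔣₀·(p)^e`**, when `χ₀` is unramified off `𝔣₀` (§1 (c)) and `θ' = χ₀` wherever `κ₁ = κ₂ = 1`.
[cite: NeukirchANT1999, Ch. VI §6 Cor. (6.6)] [cite: Washington1997, Prop. 13.2] -/
theorem frameSupp_unramified (hkerχ : ∀ g : absoluteGaloisGroup K, κ₁ g = 1 → κ₂ g = 1 → θ' g = χ₀ g) {𝔣₀ : Ideal (𝓞 K)}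
    (hunr : ∀ w : HeightOneSpectrum (𝓞 K), ¬ 𝔣₀ ≤ w.asIdeal → ∀ 𝔓 ∈ w.primesAbove, ∀ τ ∈ 𝔓.inertia (absoluteGaloisGroup K), χ₀ τ = 1) (e : ℕ) :
    ∀ w ∉ suppPF p (𝔣₀ * Ideal.span {((p : ℕ) : 𝓞 K)} ^ e),
      ∀ 𝔓 ∈ w.primesAbove, ∀ τ ∈ 𝔓.inertia (absoluteGaloisGroup K), θ' τ = 1 := by
  intro w hw 𝔓 h𝔓 τ hτ
  obtain ⟨hpw, hle⟩ := SmallImageRttD2Twist.not_mem_and_not_le_of_not_mem_suppPF (p := p) (dvd_mul_right 𝔣₀ _) hw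
  rw [hkerχ τ (ZpExtension.mem_kerSubgroup.mp (ZpExtension.inertia_le_kerSubgroup_holds K p κ₁ hpw h𝔓 hτ))
    (ZpExtension.mem_kerSubgroup.mp (ZpExtension.inertia_le_kerSubgroup_holds K p κ₂ hpw h𝔓 hτ))]
  exact hunr w hle 𝔓 h𝔓 τ hτ

end Summit.BirchSwinnertonDyer.BirchSwinnertonDyer.Theorems.SmallImageRttD2FrameSupport

end
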